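import Mathlib
import HarnessLib
import Literature.NumberTheory.Transcendental.KZCalculus
import Literature.NumberTheory.Transcendental.KZLogCalculus
import Literature.NumberTheory.Transcendental.KZLogCalculusProofs
import Literature.NumberTheory.Transcendental.KZSemiCanonicalReductionProofs
import Literature.NumberTheory.Transcendental.KZDominatedFamilyRelations
import Literature.NumberTheory.Transcendental.KZGroundingRelations
import Literature.NumberTheory.Transcendental.SemialgebraicMapsProofs

/-!
# Tools for `stub_integrateOutLow` (line `janus-bands`, crux `ArrangementNormalForm`)

General-purpose moves of the Kontsevich–Zagier calculus used by the stub
`stub_integrateOutLow` (namespace `…JanusBands.IntegrateOutLow`, reusable by its neighbours):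

* `of_cast`, `cast_domain`, `cast_integrand` — transport `h ▸ s` of a representation along an
  equality of dimensions;
* `of_sub_sum_cell_mem_relations` — **total-order refinement**: the dissection of a
  representation by the open order cells of finitely many pairwise distinct polynomial
  "players" (rule 1a; the ties are null);
* `exists_unfold_step`, `integrateOutLow_unfold` (registered sub-goal) — **reverse
  Newton–Leibniz unfolding** of a factor `(B − A)^j` of the integrand into `j` new letter-free
  coordinates ranging in `(A, B)` (rule 3 with the polynomial primitive `(t − A)·g`, then
  opening the closed fibres, a null change).
-/

noncomputable section

open MeasureTheory Set MvPolynomial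
open Literature.NumberTheory.Transcendental Literature.ModelTheory.ExponentialFields

namespace Summit.KontsevichZagierPeriods.ArrangementNormalForm.JanusBands

namespace IntegrateOutLow

variable {n N M : ℕ}

/-! ### Transport along an equality of dimensions -/

/-- Transport `h ▸ s` along an equality of dimensions does not change the generator. -/
theorem of_cast {c d : ℕ} (h : c = d) (s : KZ.IntegralRep c) : KZ.of (h ▸ s) = KZ.of s := by
  subst h; rfl

/-- The domain of a transported representation. -/
theorem cast_domain {c d : ℕ} (h : c = d) (s : KZ.IntegralRep c) :
    (h ▸ s).domain = {z | (fun i => z (Fin.cast h i)) ∈ s.domain} := by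
  subst h; rfl

/-- The integrand of a transported representation. -/
theorem cast_integrand {c d : ℕ} (h : c = d) (s : KZ.IntegralRep c) (z : Fin d → ℝ) :
    (h ▸ s).integrand z = s.integrand (fun i => z (Fin.cast h i)) := by
  subst h; rfl

/-- A set with uniformly bounded coordinates is bounded. -/
theorem isBounded_of_forall_abs_le {S : Set (Fin n → ℝ)} (R : ℝ)
    (h : ∀ w ∈ S, ∀ i, |w i| ≤ R) : Bornology.IsBounded S :=
  isBounded_iff_forall_norm_le.2 ⟨max R 0, fun w hw =>
    (pi_norm_le_iff_of_nonneg (le_max_right _ _)).2 fun i =>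
      (Real.norm_eq_abs _).le.trans ((h w hw i).trans (le_max_left _ _))⟩

/-- Evaluation of the affine polynomial `∑ wᵢ Xᵢ + c`. -/
theorem aeval_lin (w : Fin n → ℚ) (c : ℚ) (z : Fin n → ℝ) :
    aeval z (∑ i, C (w i) * X i + C c) = ∑ i, (w i : ℝ) * z i + c := by
  simp [map_sum]

/-- Two polynomials that differ somewhere agree only on a null set. -/
theorem volume_setOf_aeval_eq (P Q : MvPolynomial (Fin n) ℚ) (x : Fin n → ℝ)
    (hx : aeval x P ≠ aeval x Q) : volume {z : Fin n → ℝ | aeval z P = aeval z Q} = 0 := by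
  have h := volume_setOf_aeval_eq_zero (P - Q) (fun h0 => hx ?_)
  · convert h using 2 with z
    simp [sub_eq_zero]
  · have : aeval x (P - Q) = 0 := by
      rw [MvPolynomial.aeval_def, ← MvPolynomial.eval_map, h0, map_zero]
    simpa [sub_eq_zero] using this

/-- Strict monotonicity on `Fin N` from comparisons of neighbours. -/
theorem strictMono_of_succ_lt {f : Fin N → ℝ}
    (h : ∀ i : Fin N, ∀ hi : i.val + 1 < N, f i < f ⟨i.val + 1, hi⟩) : StrictMono f := by
  cases N with
  | zero => exact fun i => i.elim0
  | succ n => exact Fin.strictMono_iff_lt_succ.mpr fun i => h i.castSucc i.succ.2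

/-! ### Total-order refinement -/

section Cells

variable {ι : Type} [Fintype ι] (P : ι → MvPolynomial (Fin n) ℚ)

/-- Order cells are semialgebraic. -/
theorem isSemialgebraic_cell (σ : Fin (Fintype.card ι) ≃ ι) :
    IsSemialgebraic ℚ {z : Fin n → ℝ | StrictMono fun i => aeval z (P (σ i))} := by
  have h : ∀ i j : Fin (Fintype.card ι), IsSemialgebraic ℚ
      {z : Fin n → ℝ | i < j → aeval z (P (σ i)) < aeval z (P (σ j))} := by
    intro i j
    by_cases hij : i < j
    · simpa [hij] using isSemialgebraic_setOf_eval_lt (k := ℚ) (R := ℝ) (P (σ i)) (P (σ j))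
    · simp [hij]
  convert IsSemialgebraic.biInter Finset.univ _ (fun i _ =>
    IsSemialgebraic.biInter Finset.univ _ (fun j _ => h i j)) using 1
  ext z
  simp [StrictMono]

/-- A point at which the players take distinct values lies in some order cell (sorting). -/
theorem exists_mem_cell (z : Fin n → ℝ) (hz : Function.Injective fun u => aeval z (P u)) :
    ∃ σ : Fin (Fintype.card ι) ≃ ι, StrictMono fun i => aeval z (P (σ i)) := by
  set e := Fintype.equivFin ι
  set f : Fin (Fintype.card ι) → ℝ := fun i => aeval z (P (e.symm i))
  have hf : Function.Injective f := hz.comp e.symm.injective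
  exact ⟨(Tuple.sort f).trans e.symm,
    (Tuple.monotone_sort f).strictMono_of_injective (hf.comp (Tuple.sort f).injective)⟩

/-- The order cells of pairwise distinct players cover the space up to a null set. -/
theorem volume_compl_iUnion_cell
    (hP : ∀ u v, u ≠ v → ∃ x : Fin n → ℝ, aeval x (P u) ≠ aeval x (P v)) :
    volume (⋃ σ : Fin (Fintype.card ι) ≃ ι,
      {z : Fin n → ℝ | StrictMono fun i => aeval z (P (σ i))})ᶜ = 0 := by
  have hsub : (⋃ σ : Fin (Fintype.card ι) ≃ ι,
      {z : Fin n → ℝ | StrictMono fun i => aeval z (P (σ i))})ᶜ ⊆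
      ⋃ u : ι, ⋃ v : ι, {z | u ≠ v ∧ aeval z (P u) = aeval z (P v)} := by
    intro z hz
    by_contra h
    simp only [mem_iUnion, mem_setOf_eq, not_exists, not_and] at h
    obtain ⟨σ, hσ⟩ := exists_mem_cell P z fun u v huv => by_contra fun hne => h u v hne huv
    exact hz (mem_iUnion.2 ⟨σ, hσ⟩)
  refine measure_mono_null hsub
    (measure_iUnion_null_iff.mpr fun u => measure_iUnion_null_iff.mpr fun v => ?_)
  by_cases huv : u = v
  · simp [huv]
  · obtain ⟨x, hx⟩ := hP u v huv
    convert volume_setOf_aeval_eq (P u) (P v) x hx using 2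
    simp [huv]

/-- Distinct chains have disjoint order cells. -/
theorem cell_inter_cell {σ τ : Fin (Fintype.card ι) ≃ ι} (h : σ ≠ τ) :
    {z : Fin n → ℝ | StrictMono fun i => aeval z (P (σ i))} ∩
      {z | StrictMono fun i => aeval z (P (τ i))} = ∅ := by
  refine eq_empty_of_forall_notMem fun z ⟨hσ, hτ⟩ => h ?_
  set F : ι → ℝ := fun u => aeval z (P u)
  have hr : range (F ∘ σ) = range (F ∘ τ) := by
    rw [σ.surjective.range_comp, τ.surjective.range_comp]
  have hfg : F ∘ σ = F ∘ τ := (hσ.range_inj hτ).mp hr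
  have hF : Function.Injective F := fun u v huv => by
    have := hσ.injective (show F (σ (σ.symm u)) = F (σ (σ.symm v)) by simpa using huv)
    simpa using congrArg σ this
  exact Equiv.ext fun i => hF (congrFun hfg i)

/-- **Total-order refinement** (rule 1a). A representation is congruent to the sum of its
restrictions to the open order cells of finitely many pairwise distinct polynomial players:
the cells are disjoint and the ties are null. -/
theorem of_sub_sum_cell_mem_relations [DecidableEq ι]
    (hP : ∀ u v, u ≠ v → ∃ x : Fin n → ℝ, aeval x (P u) ≠ aeval x (P v))
    (r : KZ.IntegralRep n) :
    KZ.of r - ∑ σ : Fin (Fintype.card ι) ≃ ι, KZ.of (r.restrict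
      (r.domain ∩ {z | StrictMono fun i => aeval z (P (σ i))})
      (r.isSemialgebraic_domain.inter (isSemialgebraic_cell P σ)) inter_subset_left) ∈
      KZ.relations := by
  refine KZ.of_sub_sum_of_mem_relations Finset.univ r _
    (fun σ _ => by simp only [KZ.IntegralRep.domain_restrict,
      sdiff_eq_empty.mpr inter_subset_left, measure_empty]) (fun σ _ _ _ => rfl) ?_ ?_
  · refine measure_mono_null (fun z hz => ?_) (volume_compl_iUnion_cell P hP)
    simp only [mem_sdiff, mem_iUnion, KZ.IntegralRep.domain_restrict, mem_inter_iff,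
      Finset.mem_univ, exists_true_left, not_exists, not_and] at hz
    simpa using fun σ => hz.2 σ hz.1
  · intro σ _ τ _ hστ
    simp only [KZ.IntegralRep.domain_restrict]
    rw [show r.domain ∩ {z | StrictMono fun i => aeval z (P (σ i))} ∩
        (r.domain ∩ {z | StrictMono fun i => aeval z (P (τ i))}) = ∅ from
      eq_empty_of_forall_notMem fun z hz => by
        have h0 : z ∈ {z : Fin n → ℝ | StrictMono fun i => aeval z (P (σ i))} ∩
            {z | StrictMono fun i => aeval z (P (τ i))} := ⟨hz.1.2, hz.2.2⟩
        rw [cell_inter_cell P hστ] at h0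
        exact h0, measure_empty]

end Cells

/-! ### Reverse Newton–Leibniz unfolding -/

/-- A semialgebraic function composed with a coordinate projection is semialgebraic. -/
theorem isSemialgebraicFunOn_comp_proj (θ : Fin N → Fin M) {D : Set (Fin N → ℝ)}
    {g : (Fin N → ℝ) → ℝ} (hg : IsSemialgebraicFunOn ℚ D g) {S : Set (Fin M → ℝ)}
    (hS : IsSemialgebraic ℚ S) (hSD : ∀ z ∈ S, (fun i => z (θ i)) ∈ D) :
    IsSemialgebraicFunOn ℚ S (fun z => g (fun i => z (θ i))) := by
  rw [isSemialgebraicFunOn_iff] at hg ⊢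
  let θ' : Fin (N + 1) → Fin (M + 1) := Fin.lastCases (Fin.last M) (fun i => Fin.castSucc (θ i))
  convert hS.setOf_init_mem.inter (hg.preimage_comp θ') using 1
  ext v
  have h1 : Fin.init (v ∘ θ') = fun i => Fin.init v (θ i) := by
    ext i; simp [θ', Fin.init]
  have h2 : (v ∘ θ') (Fin.last N) = v (Fin.last M) := by simp [θ']
  simp only [mem_setOf_eq, mem_inter_iff, mem_preimage, h1, h2]
  exact ⟨fun h => ⟨h.1, hSD _ h.1, h.2⟩, fun h => ⟨h.1, h.2.2⟩⟩

/-- **One reverse Newton–Leibniz move.** If `r₀ = [τ, (B − A)·g]` with polynomials `A < B`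
on `τ`, then `[r₀] ≡ [{(x,t) | x ∈ τ, A x < t < B x}, g ∘ init]`: rule 3 along the last
coordinate with the primitive `F (x,t) = (t − A x)·g x` on the closed band, then the null
opening of the fibres. Integrability of the band side is Tonelli:
`∫|g ∘ init| = ∫ (B − A)|g|`. -/
theorem exists_unfold_step (r₀ : KZ.IntegralRep N) (A B : MvPolynomial (Fin N) ℚ)
    (g : (Fin N → ℝ) → ℝ) (hg : IsSemialgebraicFunOn ℚ r₀.domain g)
    (hAB : ∀ x ∈ r₀.domain, aeval x A < aeval x B)
    (hint : EqOn r₀.integrand (fun x => (aeval x B - aeval x A) * g x) r₀.domain) :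
    ∃ r₁ : KZ.IntegralRep (N + 1),
      r₁.domain = {z | (Fin.init z : Fin N → ℝ) ∈ r₀.domain ∧
        aeval (Fin.init z : Fin N → ℝ) A < z (Fin.last N) ∧
        z (Fin.last N) < aeval (Fin.init z : Fin N → ℝ) B} ∧
      r₁.integrand = (fun z => g (Fin.init z)) ∧ KZ.of r₀ - KZ.of r₁ ∈ KZ.relations := by
  set a : (Fin N → ℝ) → ℝ := fun x => aeval x A with ha_def
  set b : (Fin N → ℝ) → ℝ := fun x => aeval x B with hb_def
  have ha : IsSemialgebraicFunOn ℚ r₀.domain a :=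
    isSemialgebraicFunOn_aeval r₀.isSemialgebraic_domain A
  have hb : IsSemialgebraicFunOn ℚ r₀.domain b :=
    isSemialgebraicFunOn_aeval r₀.isSemialgebraic_domain B
  have hBsa : IsSemialgebraic ℚ (KZlog.band r₀.domain a b) := KZlog.isSemialgebraic_band ha hb
  have hBm : MeasurableSet (KZlog.band r₀.domain a b) :=
    IsSemialgebraic.measurableSet_holds hBsa
  have hDm : MeasurableSet r₀.domain := KZ.IntegralRep.measurableSet_domain_holds r₀
  have hW : IsSemialgebraicFunOn ℚ (KZlog.band r₀.domain a b) (fun z => g (Fin.init z)) :=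
    hg.comp_init_mono hBsa fun z hz => hz.1
  have hWint : IntegrableOn (fun z => g (Fin.init z)) (KZlog.band r₀.domain a b) := by
    refine KZlog.integrableOn_band_of_lintegral_fibre_le hDm hBm
      (fun x t => KZlog.snoc_mem_band) (KZ.aestronglyMeasurable_of_isSemialgebraicFunOn hW hBm)
      (K := r₀.integrand) ?_ r₀.integrableOn
    intro x hx
    simp only [Fin.init_snoc]
    rw [setLIntegral_const, Real.volume_Icc, hint hx, enorm_mul,
      Real.enorm_of_nonneg (sub_nonneg.2 (hAB x hx).le), mul_comm]
  let r₁c : KZ.IntegralRep (N + 1) :=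
    ⟨KZlog.band r₀.domain a b, fun z => g (Fin.init z), hBsa, hW, hWint⟩
  have hNL : KZ.of r₁c - KZ.of r₀ ∈ KZ.newtonLeibnizRel := by
    refine ⟨N, r₁c, r₀, a, b, fun z => (z (Fin.last N) - a (Fin.init z)) * g (Fin.init z), ?_,
      ha, hb, fun x hx => (hAB x hx).le, rfl, ?_, ?_, ?_, rfl⟩
    · exact IsSemialgebraicFunOn.mul_holds (IsSemialgebraicFunOn.sub_holds
        (isSemialgebraicFunOn_apply hBsa (Fin.last N))
        (ha.comp_init_mono hBsa fun z hz => hz.1)) hW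
    · intro x _
      simp only [Fin.snoc_last, Fin.init_snoc]
      fun_prop
    · intro x _ t _
      simp only [Fin.snoc_last, Fin.init_snoc, r₁c]
      simpa using ((hasDerivAt_id t).sub_const (a x)).mul_const (g x)
    · intro x hx
      simp only [Fin.snoc_last, Fin.init_snoc]
      rw [hint hx]
      ring
  set O := {z : Fin (N + 1) → ℝ | (Fin.init z : Fin N → ℝ) ∈ r₀.domain ∧
    aeval (Fin.init z : Fin N → ℝ) A < z (Fin.last N) ∧
    z (Fin.last N) < aeval (Fin.init z : Fin N → ℝ) B} with hO_def
  have hO : IsSemialgebraic ℚ O := by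
    have h1 := (r₀.isSemialgebraic_domain.setOf_init_mem (k := ℚ))
    have h2 := isSemialgebraic_setOf_eval_lt (k := ℚ) (R := ℝ) (rename Fin.castSucc A)
      (X (Fin.last N) : MvPolynomial (Fin (N + 1)) ℚ)
    have h3 := isSemialgebraic_setOf_eval_lt (k := ℚ) (R := ℝ)
      (X (Fin.last N) : MvPolynomial (Fin (N + 1)) ℚ) (rename Fin.castSucc B)
    convert (h1.inter h2).inter h3 using 1
    ext z
    simp only [hO_def, mem_setOf_eq, mem_inter_iff, aeval_rename, aeval_X, and_assoc]
    rfl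
  have hOsub : O ⊆ KZlog.band r₀.domain a b := fun z hz => ⟨hz.1, hz.2.1.le, hz.2.2.le⟩
  have hnull : volume (KZlog.band r₀.domain a b \ O) = 0 := by
    refine measure_mono_null (fun z hz => ?_)
      (measure_union_null (KZ.volume_graph_eq_zero ha) (KZ.volume_graph_eq_zero hb))
    obtain ⟨⟨hzD, h1, h2⟩, hzO⟩ := hz
    rcases h1.lt_or_eq with h1 | h1
    · rcases h2.lt_or_eq with h2 | h2
      · exact (hzO ⟨hzD, h1, h2⟩).elim
      · exact Or.inr ⟨hzD, h2⟩
    · exact Or.inl ⟨hzD, h1.symm⟩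
  refine ⟨r₁c.restrict O hO hOsub, rfl, rfl, ?_⟩
  have h1 := r₁c.of_sub_of_restrict_mem_relations hO hOsub hnull
  have h2 := KZ.newtonLeibnizRel_subset_relations hNL
  have : KZ.of r₀ - KZ.of (r₁c.restrict O hO hOsub) =
      (KZ.of r₁c - KZ.of (r₁c.restrict O hO hOsub)) - (KZ.of r₁c - KZ.of r₀) := by abel
  rw [this]
  exact KZ.relations.sub_mem h1 h2

end IntegrateOutLow

open IntegrateOutLow in
/-- **Iterated reverse Newton–Leibniz unfolding** (registered sub-goal of `stub_integrateOutLow`):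
`[D, (B − A)^j · g] ≡ [{(x, u) | x ∈ D, A x < uᵢ < B x (i < j)}, g ∘ take]` modulo the KZ
moves, for polynomials `A < B` on the `ℚ`-semialgebraic `D` and `g` semialgebraic with
`(B − A)^j g` absolutely integrable: `j` reverse rule-3 moves with the polynomial primitives
`(t − A)·(…)`, every intermediate representation being absolutely integrable (same `L¹` norm,
Tonelli), the closed fibres opened by null changes. -/
theorem integrateOutLow_unfold (N : ℕ) (D : Set (Fin N → ℝ)) (hD : Literature.ModelTheory.ExponentialFields.IsSemialgebraic ℚ D) (A B : MvPolynomial (Fin N) ℚ) (hAB : ∀ x ∈ D, MvPolynomial.aeval x A < MvPolynomial.aeval x B) : ∀ (j : ℕ) (g : (Fin N → ℝ) → ℝ), IsSemialgebraicFunOn ℚ D g → IntegrableOn (fun x => (MvPolynomial.aeval x B - MvPolynomial.aeval x A) ^ j * g x) D → ∃ U : KZ.IntegralRep (N + j), U.domain = {z | (fun i => z (Fin.castAdd j i)) ∈ D ∧ ∀ i : Fin j, MvPolynomial.aeval (fun i => z (Fin.castAdd j i)) A < z (Fin.natAdd N i) ∧ z (Fin.natAdd N i) < MvPolynomial.aeval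 (fun i => z (Fin.castAdd j i)) B} ∧ U.integrand = (fun z => g (fun i => z (Fin.castAdd j i))) ∧ ∀ r₀ : KZ.IntegralRep N, r₀.domain = D → EqOn r₀.integrand (fun x => (MvPolynomial.aeval x B - MvPolynomial.aeval x A) ^ j * g x) D → KZ.of r₀ - KZ.of U ∈ KZ.relations
  | 0, g, hg, hi => by
    have hi' : IntegrableOn g D := by simpa using hi
    let U : KZ.IntegralRep N := ⟨D, g, hD, hg, hi'⟩
    refine ⟨U, ?_, rfl, fun r₀ hr₀ hr₀i => ?_⟩
    · ext z; simp [U]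
    · exact KZ.of_sub_of_mem_relations_of_eqOn (by rw [hr₀]) fun x hx => by
        rw [hr₀] at hx; simpa using hr₀i hx
  | j + 1, g, hg, hi => by
    have hg' : IsSemialgebraicFunOn ℚ D (fun x => (aeval x B - aeval x A) * g x) :=
      IsSemialgebraicFunOn.mul_holds ((isSemialgebraicFunOn_aeval hD (B - A)).congr
        fun x _ => by simp) hg
    have hfun : (fun x => (aeval x B - aeval x A) ^ (j + 1) * g x) =
        fun x => (aeval x B - aeval x A) ^ j * ((aeval x B - aeval x A) * g x) := by
      funext x; rw [pow_succ, mul_assoc]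
    rw [hfun] at hi
    obtain ⟨U', hU'd, hU'i, hU'r⟩ := integrateOutLow_unfold N D hD A B hAB j _ hg' hi
    obtain ⟨U, hUd, hUi, hUr⟩ := exists_unfold_step U' (rename (Fin.castAdd j) A)
      (rename (Fin.castAdd j) B) (fun z => g (fun i => z (Fin.castAdd j i)))
      (isSemialgebraicFunOn_comp_proj (Fin.castAdd j) hg U'.isSemialgebraic_domain
        fun z hz => by rw [hU'd] at hz; exact hz.1)
      (fun z hz => by
        rw [hU'd] at hz
        rw [aeval_rename, aeval_rename]
        exact hAB _ hz.1)
      (fun z hz => by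
        rw [hU'i]
        simp only [aeval_rename]
        rfl)
    refine ⟨U, ?_, ?_, fun r₀ hr₀ hr₀i => ?_⟩
    · rw [hUd, hU'd]
      ext z
      simp only [mem_setOf_eq, aeval_rename, Fin.forall_fin_succ']
      exact and_assoc
    · rw [hUi]
      rfl
    · rw [hfun] at hr₀i
      have h1 := hU'r r₀ hr₀ hr₀i
      have : KZ.of r₀ - KZ.of U = (KZ.of r₀ - KZ.of U') + (KZ.of U' - KZ.of U) := by abel
      rw [this]
      exact KZ.relations.add_mem h1 hUr


end Summit.KontsevichZagierPeriods.ArrangementNormalForm.JanusBands
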